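import Summits.AnomalousDissipation.AnomalousDissipation.Theorems.GalerkinSteadyZerothLaw.Negative.StokesStates
import Summits.AnomalousDissipation.AnomalousDissipation.Theorems.MirrorVarietyGalerkinSteadyZerothLawCellCore
import Literature.Analysis.FluidPDE.NSGalerkinStationary

/-!
# Strategist census S3 — typed objects (crux `MirrorVariety.GalerkinSteadyZerothLaw`, stmt-AnomalousDissipation-2986)

Companion to `STRATEGY-CENSUS.md` v4 (crux-strategist s3, 2026-08-17).  Nothing here is a registered line; the file
types the objects the census argues about and PROVES the one piece of glue every cell-force finder needs:

* `CellLoudStateAt ν E ε` — "frequently in the resolution `N`, the cell-forced Galerkin system at viscosity `ν` has a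
  real solenoidal steady state of energy `≤ E` and loudness `≥ ε`" (coefficient level, the vocabulary of the live
  skeleton `Lines/laminar_component_split.lean`, whose §1 is re-proved in §0 here because that module has no farm
  olean).  NO branch, NO component, NO connection to the laminar state.
* `galerkinSteadyZerothLaw_of_cellLoudStates` (sorry-free): loud bounded cell states along ANY `ν_j → 0⁺` give the crux.
  This is the whole logic of a "harvest equilibria at each `ν_j` independently" finder (census §Strengthen S10, crux idea
  `turbulence-embedded-equilibria`): the crux asks for `∃` at each `ν_j`, never for a continuum — the split R ∧ L of the
  live line ADDED connectedness as structure; a harvest finder drops it.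
* `CellTurbulentEquilibria` — the strengthening S10 (all small `ν`, cell force) and its trivial descent to the crux.
* `firstRung_turbulenceEmbeddedEquilibrium` — the crux idea's FIRST LEMMA as a signature (a `sorry`d stub, decidable in
  spirit: one nondegenerate loud bounded 3-D steady state of the cell force at a viscosity where the laminar-connected
  3-D branch is already quiet, K-2 interim 2, plus Brezzi–Rappaz–Raviart convergence for all larger `N`).
-/

noncomputable section

set_option linter.dupNamespace false

open scoped InnerProductSpace Topology
open MeasureTheory Filter Set UnitAddTorus
open Literature.Analysis.FunctionSpaces Literature.Analysis.FunctionSpaces.Torus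
open Literature.Analysis.FluidPDE Literature.Analysis.FluidPDE.Torus

namespace Summit.AnomalousDissipation.AnomalousDissipation.Cruxes.GalerkinSteadyZerothLaw.StrategistS3

open Summit.AnomalousDissipation.AnomalousDissipation.Theorems.GalerkinSteadyZerothLaw (cellCoeff cellShell stub_cellCoreTools)
open Summit.AnomalousDissipation.AnomalousDissipation.Theses.MirrorVariety (GalerkinSteadyZerothLaw)
open Summit.AnomalousDissipation.AnomalousDissipation.Theorems.GalerkinSteadyZerothLaw.Negative
  (SteadyState FrequentlyLoud LoudWitness crux_iff fieldOf steadyState_fieldOf integral_norm_sq_fieldOf loudness_fieldOf)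
open Summit.AnomalousDissipation.AnomalousDissipation.Theorems.LaminarNeverLoud.Negative
  (modes forceCoeff modes_symm zero_not_mem_modes)

/-! ## §0 The cell force field (re-proved from the live skeleton `Lines/laminar_component_split.lean`, whose module has
no farm olean; verbatim copy of `coeffExt_cell_two` / `cellForce_admissible` there) -/

/-- The zero-extension of the level-`2` cell vector is the whole family `cellCoeff` (support in `modes 2`). [folklore] -/
theorem coeffExt_cell_two :
    coeffExt (modes (Fin 3) 2) (fun k : ↥(modes (Fin 3) 2) => cellCoeff k) = cellCoeff := by
  funext k
  by_cases hk : k ∈ modes (Fin 3) 2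
  · rw [coeffExt_of_mem _ hk]
  · rw [coeffExt_of_not_mem _ hk, stub_cellCoreTools.1 k hk]

/-- **The cell force field** `f_cell := fieldOf 2 (cellCoeff|modes 2)`: smooth, divergence free, mean zero, square
integrable, and its Fourier force vector at EVERY level `N` is `cellCoeff` read on `modes N`. [folklore] -/
theorem cellForce_admissible :
    IsSmooth (fieldOf 2 (fun k : ↥(modes (Fin 3) 2) => cellCoeff k)) ∧
    IsDivFree (fieldOf 2 (fun k : ↥(modes (Fin 3) 2) => cellCoeff k)) ∧
    HasZeroMean (fieldOf 2 (fun k : ↥(modes (Fin 3) 2) => cellCoeff k)) ∧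
    MemLp (fieldOf 2 (fun k : ↥(modes (Fin 3) 2) => cellCoeff k)) 2 volume ∧
    ∀ N : ℕ, forceCoeff (modes (Fin 3) N) (fieldOf 2 (fun k : ↥(modes (Fin 3) 2) => cellCoeff k)) =
      fun k : ↥(modes (Fin 3) N) => cellCoeff k := by
  have hC₂ : (fun k : ↥(modes (Fin 3) 2) => cellCoeff k) ∈ galerkinSubspace (modes (Fin 3) 2) :=
    (stub_cellCoreTools.2 2 le_rfl).1
  have hS : ∀ k ∈ modes (Fin 3) 2, -k ∈ modes (Fin 3) 2 := modes_symm 2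
  have hS0 : (0 : Fin 3 → ℤ) ∉ modes (Fin 3) 2 := zero_not_mem_modes 2
  have hCsymm : IsConjSymm (coeffExt (modes (Fin 3) 2) (fun k : ↥(modes (Fin 3) 2) => cellCoeff k)) :=
    hC₂.1.isConjSymm_coeffExt hS
  have hCT : IsTransversal (modes (Fin 3) 2) (coeffExt (modes (Fin 3) 2) (fun k : ↥(modes (Fin 3) 2) => cellCoeff k)) :=
    hC₂.2.isTransversal_coeffExt
  have hfs : IsSmooth (fieldOf 2 (fun k : ↥(modes (Fin 3) 2) => cellCoeff k)) := isSmooth_realTrigPoly _ _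
  refine ⟨hfs, isDivFree_realTrigPoly hCT, hasZeroMean_realTrigPoly_of_zero_not_mem hS0 _,
    hfs.continuous.memLp_of_hasCompactSupport (HasCompactSupport.of_compactSpace _), fun N => ?_⟩
  funext k
  show mFourierCoeff (EuclideanSpace.complexify ∘
      realTrigPoly (modes (Fin 3) 2) (coeffExt (modes (Fin 3) 2) (fun k : ↥(modes (Fin 3) 2) => cellCoeff k)))
      (k : Fin 3 → ℤ) = cellCoeff k
  rw [mFourierCoeff_realTrigPoly hS hCsymm, coeffExt_cell_two]
  split_ifs with hk
  · rfl
  · exact (stub_cellCoreTools.1 k hk).symm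

/-! ## §1 Loud bounded cell states at one viscosity, frequently in the resolution -/

/-- `CellLoudStateAt ν E ε`: for infinitely many resolutions `N` the cell-forced Fourier–Galerkin system on the punctured
ball `modes (Fin 3) N` has, at viscosity `ν`, a real solenoidal steady state `c` with `Σ‖c_k‖² ≤ E` (= `∫‖U‖²`) and
`ν · 4π² Σ|k|²‖c_k‖² ≥ ε` (= `ν‖∇U‖²`).  One viscosity, no branch structure. [folklore] -/
def CellLoudStateAt (ν E ε : ℝ) : Prop :=
  ∃ᶠ N in atTop, ∃ c : ↥(modes (Fin 3) N) → EuclideanSpace ℂ (Fin 3),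
    c ∈ galerkinSubspace (modes (Fin 3) N) ∧
    galerkinRHS (modes (Fin 3) N) ν (fun k : ↥(modes (Fin 3) N) => cellCoeff k) c = 0 ∧
    ∑ k : ↥(modes (Fin 3) N), ‖c k‖ ^ 2 ≤ E ∧
    ε ≤ ν * (4 * Real.pi ^ 2 * ∑ k : ↥(modes (Fin 3) N), freqNormSq (k : Fin 3 → ℤ) * ‖c k‖ ^ 2)

/-- **Glue for every cell-force finder.**  Loud bounded cell states along any positive null sequence of viscosities give
the crux `GalerkinSteadyZerothLaw` (witness force = the cell force): the landed dictionary `fieldOf` /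
`steadyState_fieldOf` / Parseval / `loudness_fieldOf` and `crux_iff`.  No connectedness, no laminar anchor. [folklore] -/
theorem galerkinSteadyZerothLaw_of_cellLoudStates (ν : ℕ → ℝ) (E ε : ℝ) (hν : ∀ j, 0 < ν j)
    (hlim : Tendsto ν atTop (𝓝 0)) (hε : 0 < ε) (h : ∀ j, CellLoudStateAt (ν j) E ε) :
    GalerkinSteadyZerothLaw := by
  obtain ⟨hfs, hfd, hfm, hfmem, hfcoeff⟩ := cellForce_admissible
  refine crux_iff.2 ⟨fieldOf 2 (fun k : ↥(modes (Fin 3) 2) => cellCoeff k), hfs, hfd, hfm, ν, E, ε, hν, hlim, hε,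
    fun j => ?_⟩
  refine (h j).mono ?_
  rintro N ⟨c, hcV, hc0, hcE, hcloud⟩
  refine ⟨fieldOf N c, steadyState_fieldOf hfmem hcV ?_, ?_, ?_⟩
  · rw [hfcoeff N]
    exact hc0
  · rw [integral_norm_sq_fieldOf hcV]
    exact hcE
  · rw [loudness_fieldOf (ν j) hcV]
    exact hcloud

/-! ## §2 The strengthening S10 (`CellTurbulentEquilibria`) and its descent -/

/-- S10 (census §Strengthen): loud bounded cell states at EVERY sufficiently small viscosity — the statement a
"turbulence-embedded equilibria" finder would be accumulating evidence for.  Strictly stronger than the crux at the cell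
force (all small `ν` instead of one sequence); NOT a registered stub (its logic is the crux at a fixed force). [folklore] -/
def CellTurbulentEquilibria : Prop :=
  ∃ E ε νstar : ℝ, 0 < ε ∧ 0 < νstar ∧ ∀ ν : ℝ, 0 < ν → ν ≤ νstar → CellLoudStateAt ν E ε

/-- S10 descends to the crux along `ν_j := ν⋆/(j+1)`. [folklore] -/
theorem galerkinSteadyZerothLaw_of_cellTurbulentEquilibria (h : CellTurbulentEquilibria) : GalerkinSteadyZerothLaw := by
  obtain ⟨E, ε, νstar, hε, hνstar, hall⟩ := h
  have hpos : ∀ j : ℕ, 0 < νstar / ((j : ℝ) + 1) := fun j => by positivity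
  have hle : ∀ j : ℕ, νstar / ((j : ℝ) + 1) ≤ νstar := fun j => by
    have h1 : (1 : ℝ) ≤ (j : ℝ) + 1 := by
      have : (0 : ℝ) ≤ j := Nat.cast_nonneg j
      linarith
    exact div_le_self hνstar.le h1
  have hlim : Tendsto (fun j : ℕ => νstar / ((j : ℝ) + 1)) atTop (𝓝 0) := by
    have h1 : Tendsto (fun j : ℕ => (j : ℝ) + 1) atTop atTop :=
      tendsto_natCast_atTop_atTop.atTop_add tendsto_const_nhds
    exact tendsto_const_nhds.div_atTop h1
  exact galerkinSteadyZerothLaw_of_cellLoudStates (fun j => νstar / ((j : ℝ) + 1)) E ε hpos hlim hε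
    (fun j => hall _ (hpos j) (hle j))

/-! ## §3 The crux idea's first lemma, as a signature (NOT a registered stub) -/

/-- FIRST LEMMA of crux idea `turbulence-embedded-equilibria` (census §Strengthen S10 / recommendation R2): at some
viscosity `ν ≤ 1/500` — below the last laminar-connected loud regime of the cell force (K-2 interim 2: the primary 3-D
branch has `E ≈ 0.22`, `ε ≈ 0.1` there and keeps falling; the DNS attractor has `⟨E⟩ = 1.83`, `⟨ε⟩ = 0.745` at
`ν = 1.5·10⁻³`) — there is, frequently in `N`, a steady cell state with `Σ‖c_k‖² ≤ 4` and `ν‖∇U‖² ≥ 1/4`.  Decidable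
in spirit: ONE nondegenerate steady state at one `N⋆`, certified by interval Newton, plus Brezzi–Rappaz–Raviart /
`exists_zero_of_infSup_newton` for all `N ≥ N⋆`.  Falsifiable in spirit by an exhaustive deflation census at that `ν`.
Left as `sorry`: it is a finder target, not a claim. [folklore] -/
theorem firstRung_turbulenceEmbeddedEquilibrium :
    ∃ ν : ℝ, 0 < ν ∧ ν ≤ 1 / 500 ∧ CellLoudStateAt ν 4 (1 / 4) := by
  sorry

end Summit.AnomalousDissipation.AnomalousDissipation.Cruxes.GalerkinSteadyZerothLaw.StrategistS3

end
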